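import Mathlib
import HarnessLib
import Literature.NumberTheory.Transcendental.KZCalculus
import Literature.NumberTheory.Transcendental.KZSemiCanonicalReductionProofs
import Literature.NumberTheory.Transcendental.KZLogCalculusProofs
import Literature.NumberTheory.Transcendental.KZSemialgebraicComplex
import Literature.NumberTheory.Transcendental.SemialgebraicMapsProofs
import Literature.NumberTheory.Transcendental.KZCubeRational
import Literature.NumberTheory.Transcendental.MZVSimplexRep
import Literature.NumberTheory.Transcendental.KZProductIdeal

/-!
# Route RootDecompZetaThreeFrontier / RootDecompWeightFrontier — support collapse for item 27223 `HigherWeightDescent` — part 1/3 (`…SupportCollapseGenusZero`): polynomial primitives in one coordinate, the genus-zero denominator data (`gzDen`, `gzDenP`, `Singular`, `lo`/`hi`), inserting a coordinate into a strictly decreasing tuple, moving a coordinate to the last slot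

Theorems-split (3 files ≤ 400 lines, sequential imports) of the decomp-kz lens-1 gen-6 file
`run/shared/lean/pub/decomp-kz/decomp-kz-lens-1/g6/landing/RootDecompZetaThreeFrontierSupportCollapse.lean` (= SupportCollapse.lean @3ef2cb59,
882 lines; lens farm rc 0 / 0 err / 0 warn / 0 sorry, standard axioms; critic decomp-kz-crit-1 g2 CLEARED 2026-08-30T06:31:48Z; landing ask L9 of the
writer), landed by the census seat decomp-kz-census-1 g6 (--supports stmt-KontsevichZagierPeriods-27223). Content: pole-free variables of a genus-zero
representation are ELIMINATED INSIDE the KZ calculus (rule-2 reindexing + ONE rule-3 Newton–Leibniz move over the band `lo < t < hi` with a RATIONAL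
primitive), so the `ν ≤ 3` column of `HigherWeightDescent` (item 27223; all weights, all `k ≥ 4`) is a THEOREM and the item is EQUIVALENT to its
saturated re-cut. The Newton–Leibniz package of `…JanusBands.IntegrateOut` (item 3915; module unbuilt on the farm today) is carried as PRIVATE copies
in part 2. [Kontsevich–Zagier 2001 §1.2] Standard axioms, 0 sorry.
-/

noncomputable section

set_option linter.dupNamespace false

open Set MeasureTheory MvPolynomial
open Literature.NumberTheory.Transcendental
open Literature.ModelTheory.ExponentialFields

namespace Summit.KontsevichZagierPeriods.KontsevichZagierPeriods.Theorems.RootDecompZetaThreeFrontierSupportCollapse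

variable {k : ℕ}

/-- A primitive of `p` in the coordinate `i`: `∑ c·t^s ↦ ∑ c/(sᵢ+1) · t^{s+eᵢ}`. [folklore] -/
def antider {N : ℕ} (i : Fin N) (p : MvPolynomial (Fin N) ℚ) : MvPolynomial (Fin N) ℚ :=
  ∑ s ∈ p.support, monomial (s + Finsupp.single i 1) (coeff s p / ((s i : ℚ) + 1))

/-- `∂ᵢ (antider i p) = p`. [folklore] -/
theorem pderiv_antider {N : ℕ} (i : Fin N) (p : MvPolynomial (Fin N) ℚ) :
    pderiv i (antider i p) = p := by
  unfold antider
  rw [map_sum]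
  conv_rhs => rw [← p.support_sum_monomial_coeff]
  refine Finset.sum_congr rfl fun s _ => ?_
  rw [pderiv_monomial, add_tsub_cancel_right]
  congr 1
  rw [Finsupp.add_apply, Finsupp.single_eq_same, Nat.cast_add, Nat.cast_one, div_mul_cancel₀]
  exact Nat.cast_add_one_ne_zero _

/-- Helper (theorem) `aeval_bind₁_snoc` of the support-collapse chain for item 27223 (lens-1 g6). -/
theorem aeval_bind₁_snoc {k : ℕ} (x : Fin k → ℝ) (U : MvPolynomial (Fin k) ℚ)
    (F : MvPolynomial (Fin (k + 1)) ℚ) :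
    aeval x (bind₁ (Fin.snoc (fun i : Fin k => (X i : MvPolynomial (Fin k) ℚ)) U) F) =
      aeval (Fin.snoc x (aeval x U) : Fin (k + 1) → ℝ) F := by
  have h : (fun i => aeval x ((Fin.snoc (fun i : Fin k => (X i : MvPolynomial (Fin k) ℚ)) U
      : Fin (k + 1) → MvPolynomial (Fin k) ℚ) i)) = (Fin.snoc x (aeval x U) : Fin (k + 1) → ℝ) := by
    funext i
    cases i using Fin.lastCases with
    | last => simp
    | cast j => simp
  rw [aeval_bind₁, h]

/-- The genus-zero denominator `(∏ tᵢ^{bᵢ}) (∏ (1-tᵢ)^{cᵢ}) ∏_{i<j} (tᵢ-tⱼ)^{aᵢⱼ}` of item 27223,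
VERBATIM. -/
def gzDen (a : Fin k → Fin k → ℕ) (b c : Fin k → ℕ) (t : Fin k → ℝ) : ℝ :=
  (∏ i, t i ^ b i) * (∏ i, (1 - t i) ^ c i) * ∏ i, ∏ j, if i < j then (t i - t j) ^ a i j else 1

/-- The same denominator as a polynomial with rational coefficients. -/
def gzDenP (a : Fin k → Fin k → ℕ) (b c : Fin k → ℕ) : MvPolynomial (Fin k) ℚ :=
  (∏ i, X i ^ b i) * (∏ i, (1 - X i) ^ c i) * ∏ i, ∏ j, if i < j then (X i - X j) ^ a i j else 1

/-- Helper (theorem) `aeval_gzDenP` of the support-collapse chain for item 27223 (lens-1 g6). -/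
theorem aeval_gzDenP (a : Fin k → Fin k → ℕ) (b c : Fin k → ℕ) (t : Fin k → ℝ) :
    (aeval t (gzDenP a b c) : ℝ) = gzDen a b c t := by
  have h3 : ∀ i j : Fin k,
      (aeval t (if i < j then (X i - X j) ^ a i j else 1 : MvPolynomial (Fin k) ℚ) : ℝ) =
        if i < j then (t i - t j) ^ a i j else 1 := by
    intro i j
    split_ifs <;> simp
  simp only [gzDenP, gzDen, map_mul, map_prod, map_pow, map_sub, map_one, aeval_X, h3]

/-- The denominator does not vanish on the open ordered simplex. -/
theorem gzDen_ne_zero (a : Fin k → Fin k → ℕ) (b c : Fin k → ℕ) {y : Fin k → ℝ}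
    (hy : y ∈ KZ.openOrderedSimplex k) : gzDen a b c y ≠ 0 := by
  obtain ⟨h0, h1, ha⟩ := hy
  refine mul_ne_zero (mul_ne_zero ?_ ?_) ?_
  · exact Finset.prod_ne_zero_iff.mpr fun i _ => pow_ne_zero _ (h0 i).ne'
  · exact Finset.prod_ne_zero_iff.mpr fun i _ => pow_ne_zero _ (sub_pos.mpr (h1 i)).ne'
  · refine Finset.prod_ne_zero_iff.mpr fun i _ => Finset.prod_ne_zero_iff.mpr fun j _ => ?_
    split_ifs with hij
    · exact pow_ne_zero _ (sub_pos.mpr (ha hij)).ne'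
    · exact one_ne_zero

/-- Variable `i` CARRIES A POLE of the genus-zero datum `(a, b, c)`: it occurs in `tᵢ^{-bᵢ}`,
`(1-tᵢ)^{-cᵢ}` or in some `(tᵢ-tⱼ)^{-aᵢⱼ}` / `(tⱼ-tᵢ)^{-aⱼᵢ}` with a non-zero exponent (only the
entries `a i j`, `i < j`, are read by the integrand). `ν(g)` = the number of such variables. -/
def Singular (a : Fin k → Fin k → ℕ) (b c : Fin k → ℕ) (i : Fin k) : Prop :=
  b i ≠ 0 ∨ c i ≠ 0 ∨ ∃ j, (i < j ∧ a i j ≠ 0) ∨ (j < i ∧ a j i ≠ 0)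

/-- Helper (theorem) `not_singular_iff` of the support-collapse chain for item 27223 (lens-1 g6). -/
theorem not_singular_iff {a : Fin k → Fin k → ℕ} {b c : Fin k → ℕ} {i : Fin k} :
    ¬ Singular a b c i ↔
      b i = 0 ∧ c i = 0 ∧ ∀ j, (i < j → a i j = 0) ∧ (j < i → a j i = 0) := by
  simp only [Singular, not_or, not_exists, not_and, not_not, ne_eq]

/-- Contracting the datum along `v.succAbove` does not create poles. -/
theorem singular_of_contract {v : Fin (k + 1)} {a : Fin (k + 1) → Fin (k + 1) → ℕ}
    {b c : Fin (k + 1) → ℕ} {i : Fin k}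
    (h : Singular (fun i j => a (v.succAbove i) (v.succAbove j)) (fun i => b (v.succAbove i))
      (fun i => c (v.succAbove i)) i) :
    Singular a b c (v.succAbove i) := by
  rcases h with h | h | ⟨j, hj⟩
  · exact Or.inl h
  · exact Or.inr (Or.inl h)
  · refine Or.inr (Or.inr ⟨v.succAbove j, ?_⟩)
    rcases hj with ⟨hij, hne⟩ | ⟨hji, hne⟩
    · exact Or.inl ⟨(Fin.strictMono_succAbove v) hij, hne⟩
    · exact Or.inr ⟨(Fin.strictMono_succAbove v) hji, hne⟩

/-- Helper (theorem) `strictAnti_insertNth_iff` of the support-collapse chain for item 27223 (lens-1 g6). -/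
theorem strictAnti_insertNth_iff (v : Fin (k + 1)) (t : ℝ) (y : Fin k → ℝ) :
    StrictAnti (v.insertNth t y : Fin (k + 1) → ℝ) ↔
      StrictAnti y ∧ (∀ j : Fin k, (v : ℕ) ≤ j → y j < t) ∧ (∀ j : Fin k, (j : ℕ) < v → t < y j) := by
  constructor
  · intro h
    refine ⟨fun i j hij => ?_, fun j hj => ?_, fun j hj => ?_⟩
    · have := h ((Fin.strictMono_succAbove v) hij)
      simpa only [Fin.insertNth_apply_succAbove] using this
    · have hlt : v < v.succAbove j :=
        (Fin.lt_succAbove_iff_le_castSucc v j).mpr (Fin.le_def.mpr (by simpa using hj))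
      have := h hlt
      simpa only [Fin.insertNth_apply_succAbove, Fin.insertNth_apply_same] using this
    · have hlt : v.succAbove j < v :=
        (Fin.succAbove_lt_iff_castSucc_lt v j).mpr (Fin.lt_def.mpr (by simpa using hj))
      have := h hlt
      simpa only [Fin.insertNth_apply_succAbove, Fin.insertNth_apply_same] using this
  · rintro ⟨hy, h1, h2⟩ i j hij
    rcases eq_or_ne i v with rfl | hi
    · rcases eq_or_ne j i with rfl | hj
      · exact absurd hij (lt_irrefl _)
      · obtain ⟨j', rfl⟩ := Fin.exists_succAbove_eq hj
        have hj' : (i : ℕ) ≤ j' := by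
          have := (Fin.lt_succAbove_iff_le_castSucc i j').mp hij
          simpa [Fin.le_def] using this
        simpa only [Fin.insertNth_apply_succAbove, Fin.insertNth_apply_same] using h1 j' hj'
    · obtain ⟨i', rfl⟩ := Fin.exists_succAbove_eq hi
      rcases eq_or_ne j v with rfl | hj
      · have hi' : (i' : ℕ) < j := by
          have := (Fin.succAbove_lt_iff_castSucc_lt j i').mp hij
          simpa [Fin.lt_def] using this
        simpa only [Fin.insertNth_apply_succAbove, Fin.insertNth_apply_same] using h2 i' hi'
      · obtain ⟨j', rfl⟩ := Fin.exists_succAbove_eq hj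
        have := (Fin.strictMono_succAbove v).lt_iff_lt.mp hij
        simpa only [Fin.insertNth_apply_succAbove] using hy this

/-- Lower limit of the inserted coordinate: the next coordinate `y_v`, or `0` if `v` is the last slot. -/
def lo (v : Fin (k + 1)) (y : Fin k → ℝ) : ℝ := if h : (v : ℕ) < k then y ⟨v, h⟩ else 0

/-- Upper limit of the inserted coordinate: the previous coordinate `y_{v-1}`, or `1` if `v = 0`. -/
def hi (v : Fin (k + 1)) (y : Fin k → ℝ) : ℝ :=
  if h : 0 < (v : ℕ) then y ⟨(v : ℕ) - 1, by have := v.isLt; omega⟩ else 1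

/-- `lo` as a polynomial. -/
def loP (v : Fin (k + 1)) : MvPolynomial (Fin k) ℚ := if h : (v : ℕ) < k then X ⟨v, h⟩ else 0

/-- `hi` as a polynomial. -/
def hiP (v : Fin (k + 1)) : MvPolynomial (Fin k) ℚ :=
  if h : 0 < (v : ℕ) then X ⟨(v : ℕ) - 1, by have := v.isLt; omega⟩ else 1

/-- Helper (theorem) `aeval_loP` of the support-collapse chain for item 27223 (lens-1 g6). -/
theorem aeval_loP (v : Fin (k + 1)) (y : Fin k → ℝ) : (aeval y (loP v) : ℝ) = lo v y := by
  unfold loP lo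
  split_ifs <;> simp

/-- Helper (theorem) `aeval_hiP` of the support-collapse chain for item 27223 (lens-1 g6). -/
theorem aeval_hiP (v : Fin (k + 1)) (y : Fin k → ℝ) : (aeval y (hiP v) : ℝ) = hi v y := by
  unfold hiP hi
  split_ifs <;> simp

/-- Helper (theorem) `isSemialgebraicFunOn_lo` of the support-collapse chain for item 27223 (lens-1 g6). -/
theorem isSemialgebraicFunOn_lo (v : Fin (k + 1)) :
    IsSemialgebraicFunOn ℚ (KZ.openOrderedSimplex k) (lo v) :=
  (isSemialgebraicFunOn_aeval (KZ.isSemialgebraic_openOrderedSimplex k) (loP v)).congr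
    fun y _ => aeval_loP v y

/-- Helper (theorem) `isSemialgebraicFunOn_hi` of the support-collapse chain for item 27223 (lens-1 g6). -/
theorem isSemialgebraicFunOn_hi (v : Fin (k + 1)) :
    IsSemialgebraicFunOn ℚ (KZ.openOrderedSimplex k) (hi v) :=
  (isSemialgebraicFunOn_aeval (KZ.isSemialgebraic_openOrderedSimplex k) (hiP v)).congr
    fun y _ => aeval_hiP v y

/-- Helper (theorem) `lo_lt_hi` of the support-collapse chain for item 27223 (lens-1 g6). -/
theorem lo_lt_hi (v : Fin (k + 1)) {y : Fin k → ℝ} (hy : y ∈ KZ.openOrderedSimplex k) :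
    lo v y < hi v y := by
  obtain ⟨hy0, hy1, hya⟩ := hy
  unfold lo hi
  split_ifs with h1 h2 h2
  · exact hya (Fin.mk_lt_mk.mpr (by omega))
  · exact hy1 _
  · exact hy0 _
  · exact one_pos

/-- **The open ordered simplex as an open band in the `v`-th coordinate**: inserting `t` at slot `v`
into `y` gives a point of `Δ_{k+1}` iff `y ∈ Δ_k` and `lo v y < t < hi v y`. -/
theorem insertNth_mem_simplex_iff (v : Fin (k + 1)) (t : ℝ) (y : Fin k → ℝ) :
    (v.insertNth t y : Fin (k + 1) → ℝ) ∈ KZ.openOrderedSimplex (k + 1) ↔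
      y ∈ KZ.openOrderedSimplex k ∧ lo v y < t ∧ t < hi v y := by
  simp only [KZ.openOrderedSimplex, mem_setOf_eq, Fin.forall_iff_succAbove v, Fin.insertNth_apply_same,
    Fin.insertNth_apply_succAbove, strictAnti_insertNth_iff]
  constructor
  · rintro ⟨⟨ht0, hy0⟩, ⟨ht1, hy1⟩, hy, h1, h2⟩
    refine ⟨⟨hy0, hy1, hy⟩, ?_, ?_⟩
    · unfold lo
      split_ifs with h
      · exact h1 ⟨v, h⟩ le_rfl
      · exact ht0
    · unfold hi
      split_ifs with h
      · exact h2 ⟨(v : ℕ) - 1, by have := v.isLt; omega⟩ (by dsimp only; omega)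
      · exact ht1
  · rintro ⟨⟨hy0, hy1, hy⟩, hlo, hhi⟩
    have ht0 : 0 < t := by
      unfold lo at hlo
      split_ifs at hlo with h
      · exact (hy0 _).trans hlo
      · exact hlo
    have ht1 : t < 1 := by
      unfold hi at hhi
      split_ifs at hhi with h
      · exact hhi.trans (hy1 _)
      · exact hhi
    refine ⟨⟨ht0, hy0⟩, ⟨ht1, hy1⟩, hy, fun j hj => ?_, fun j hj => ?_⟩
    · unfold lo at hlo
      split_ifs at hlo with h
      · exact (hy.antitone (show (⟨v, h⟩ : Fin k) ≤ j from Fin.le_def.mpr (by simpa using hj))).trans_lt hlo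
      · exact absurd (lt_of_lt_of_le j.isLt (not_lt.mp h)) (not_lt.mpr hj)
    · unfold hi at hhi
      split_ifs at hhi with h
      · exact hhi.trans_le (hy.antitone (show j ≤ ⟨(v : ℕ) - 1, _⟩ from Fin.le_def.mpr (by dsimp only; omega)))
      · omega

/-- The coordinate permutation with `moveLast v v = last` and `moveLast v (v.succAbove j) = castSucc j`. -/
def moveLast (v : Fin (k + 1)) : Fin (k + 1) ≃ Fin (k + 1) :=
  (finSuccEquiv' v).trans (finSuccEquiv' (Fin.last k)).symm

/-- Helper (theorem) `moveLast_apply_self` of the support-collapse chain for item 27223 (lens-1 g6). -/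
@[simp] theorem moveLast_apply_self (v : Fin (k + 1)) : moveLast v v = Fin.last k := by
  simp [moveLast, finSuccEquiv'_at, finSuccEquiv'_symm_none]

/-- Helper (theorem) `moveLast_apply_succAbove` of the support-collapse chain for item 27223 (lens-1 g6). -/
@[simp] theorem moveLast_apply_succAbove (v : Fin (k + 1)) (j : Fin k) :
    moveLast v (v.succAbove j) = Fin.castSucc j := by
  simp [moveLast, finSuccEquiv'_succAbove, finSuccEquiv'_symm_some, Fin.succAbove_last]

/-- Reading a point through `moveLast v` = inserting its last coordinate at slot `v` into its
initial segment. -/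
theorem comp_moveLast (v : Fin (k + 1)) (w : Fin (k + 1) → ℝ) :
    (fun i => w (moveLast v i)) = (v.insertNth (w (Fin.last k)) (Fin.init w) : Fin (k + 1) → ℝ) := by
  funext i
  revert i
  refine (Fin.forall_iff_succAbove v).mpr ⟨?_, fun j => ?_⟩
  · simp [Fin.insertNth_apply_same]
  · simp [Fin.insertNth_apply_succAbove, Fin.init]

end Summit.KontsevichZagierPeriods.KontsevichZagierPeriods.Theorems.RootDecompZetaThreeFrontierSupportCollapse
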